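import Mathlib.Analysis.InnerProductSpace.Calculus
import Mathlib.Analysis.Calculus.Deriv.Mul
import Mathlib.Analysis.Calculus.Deriv.Pow
import Mathlib.Analysis.Calculus.Deriv.Comp
import Mathlib.MeasureTheory.Integral.Bochner.Basic
import Literature.Analysis.FluidPDE.LinearizedHsEuler
import HarnessLib

/-!
# The Chu disturbance energy of a compressible perturbation

Topic `Literature/Analysis/FluidPDE` (definition item `defn-optimalAmplification`, part (1) of the
request of route `AnnealedZeroHorizon` / item `OnsetLawR`, `stmt-AtomisticToContinuum-13797`;
part (2), the optimal amplification `G(t₁; t₀)`, is `OptimalAmplification.lean`).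

**The notion.** For a small perturbation of a compressible fluid about a background with density
`ρ_b`, temperature `θ_b`, written in PRIMITIVE fluctuations `(ρ′, u′, θ′)`, the Chu (1965) /
Mack (1969) / Hanifi–Schmid–Henningson (1996) disturbance energy is the positive quadratic form

`E = ½ ∫ [ ρ_b |u′|² + ((∂p/∂ρ)_θ / ρ_b) ρ′² + (ρ_b c_v / θ_b) θ′² ] dx`,

the unique choice of weights (up to a factor) for which the linearised INVISCID equations about a
UNIFORM state at rest conserve `E`: the compression-work ("pressure-dilatation") transfer terms
combine into the divergence `−div(p′u′)` (Chu 1965; Hanifi–Schmid–Henningson 1996, §II: "the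
pressure-related transfer terms are conservative"; for the ideal gas `p = ρRθ`,
`(∂p/∂ρ)_θ = Rθ_b`, it is Mack's energy norm
`diag(T̄/(γM²ρ̄), ρ̄, ρ̄, ρ̄, ρ̄/(γ(γ−1)T̄M²))` on `(ρ′, u′, v′, w′, T′)`, restated as eq. (6),
PDF p. 12, of Paredes et al., AIAA 2018-0057, and — in `(p′, s′)` variables — as eq. (5), PDF p. 4
of Dwivedi et al. 2020). `chuEnergyDensity_hasDerivAt_of_linearizedEuler` below PROVES this
defining property pointwise for an arbitrary equation of state `p(ρ, θ)` with constant `c_v`.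

**The hard-sphere specialisation.** The requesting route perturbs the hard-sphere gas
(`HardSphereEuler.lean`: `p = hsPressure σ ρ θ = ρ θ Z(ρσ³)`, internal energy `(3/2)θ` per
particle, so `c_v = 3/2` and `(∂p/∂ρ)_θ = θ (ηZ)′(η)`, `η = ρσ³`; ideal gas at `σ = 0`) in the
CONSERVATIVE variables `V : 𝕋³ → HsState = ℝ⁵` of `LinearizedHsEuler.lean`. The primitive
fluctuations of a conservative perturbation `V = (δρ, δm, δE)` at the background `(ρ_b, u_b, θ_b)`
are the derivatives of `HsState.velocity/temperature` along `V`: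
`δu = (δm − δρ u_b)/ρ_b`, `δθ = (2/(3ρ_b)) (δE − ⟪u_b, δm⟫ + (|u_b|²/2 − 3θ_b/2) δρ)`
(`HsState.linVelocity`, `HsState.linTemperature`; `hasDerivAt_consState` proves that they invert
the derivative `linConsState` of `consState`).

## Main definitions and results

* `chuEnergyDensity c_v ρ_b θ_b a ρ′ u′ θ′ = (ρ_b ‖u′‖² + (a/ρ_b) ρ′² + (ρ_b c_v/θ_b) θ′²)/2`, the
  pointwise density (`a = (∂p/∂ρ)_θ` at the background; `u′` in any real inner product space, so
  every dimension `d` is covered), and `chuEnergy c_v ρ_b θ_b a ρ′ u′ θ′ = ∫ chuEnergyDensity …`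
  over any measure space (backgrounds may vary in space). API: `chuEnergyDensity_nonneg`,
  `chuEnergyDensity_eq_zero_iff` (positive definiteness), `chuEnergyDensity_smul` (quadratic),
  `chuEnergy_nonneg`, and the conservation structure
  `chuEnergyDensity_hasDerivAt_of_linearizedEuler`:
  along the linearised Euler system at rest (`ρ′_t = −ρ_b div u′`, `ρ_b u′_t = −∇p′`,
  `ρ_b c_v θ′_t = −θ_b p_θ div u′`, `p′ = a ρ′ + p_θ θ′`) the density evolves by
  `d/dt e = −(⟪u′, ∇p′⟫ + p′ div u′) = −div(p′ u′)`.
* Hard spheres: `hsPressureDrho σ ρ θ = ∂_ρ hsPressure σ ρ θ` (`hsPressureDrho_zero_diam`: `= θ` for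
  the ideal gas; `hsPressureDrho_eq` under differentiability of `Z`), `HsState.linVelocity`,
  `HsState.linTemperature`, `linConsState` with `hasDerivAt_consState`,
  `linVelocity_linConsState`, `linTemperature_linConsState`,
  `linConsState_linVelocity_linTemperature` (mutually inverse for `ρ_b ≠ 0`);
  `hsChuEnergyDensity σ ρ_b u_b θ_b V`, `hsChuEnergy σ ρ_b u_b θ_b V = ∫_{𝕋³} …` (the requested
  `chuEnergy ρ_b θ_b V`; the background velocity is needed to extract `δu, δθ` from conservative
  variables), `hsChuEnergyDensity_linConsState` (it IS the displayed formula with `c_v = 3/2`,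
  `a = hsPressureDrho`), `hsChuEnergyDensity_zero_diam` (ideal gas: `θ_b ρ′²/ρ_b` and
  `3ρ_b θ′²/(2θ_b)`), `hsChuEnergyDensity_nonneg`, `hsChuEnergy_nonneg`.
* With `OptimalAmplification.lean`: the optimal Chu-energy growth around a time-dependent
  background `(ρ, u, θ)(t, x)` for a solution predicate `IsSol` on `V : ℝ → 𝕋³ → ℝ⁵` is
  `optimalAmplification IsSol (fun t => hsChuEnergy σ (ρ t) (u t) (θ t)) t₀ t₁`, e.g. with
  `IsSol = IsLinearizedHsEulerSolution σ T ρ u θ` (inviscid proxy) — the `G(t′; t′₀)` of the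
  onset law (the two files are independent; no abbreviation is introduced for this composite).

## Design choices and what is NOT here

* `hsPressureDrho` is Mathlib's `deriv` of the pressure law in `ρ` (junk `0` where the equation of
  state `Z = hsCompressibility` is not differentiable — it is analytic at small packing fraction,
  the named statement `HsEosLowDensity` of the routes), consistent with the `fderiv` Jacobians of
  `LinearizedHsEuler.lean`.
* The Bochner integral returns the junk value `0` for non-integrable densities; smooth fields on
  the compact torus are integrable.
* NOT here: the Chu-energy balance `dE/dt = production − dissipation` for a solution of a
  linearised Navier–Stokes–Fourier system around a PARALLEL SHEAR background (it needs the
  `linearisedHsNSF` predicate — a separate definition item — differentiation under the integral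
  and integration by parts on the torus); only its pointwise inviscid, uniform-state core is proved.

## References

* B.-T. Chu, *On the energy transfer to small disturbances in fluid flow (Part I)*, Acta Mech. 1
  (1965) 215–234 (the disturbance energy and its positive definiteness).
* A. Hanifi, P. J. Schmid, D. S. Henningson, *Transient growth in compressible boundary layer
  flow*, Phys. Fluids 8 (1996) 826–837, §II (energy norm), §III (transient growth).
* A. Dwivedi et al., Phys. Rev. Fluids 5 (2020) 063904, eqs. (5)–(6), PDF p. 4 (Chu energy,
  `G(t)`); P. Paredes et al., AIAA paper 2018-0057, eq. (6), PDF p. 12 (Mack/HSH energy matrix).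
* P. J. Schmid, D. S. Henningson, *Stability and Transition in Shear Flows*, Springer 2001, §4.4.
-/

noncomputable section

open MeasureTheory Set Filter
open _root_.Topology
open scoped InnerProductSpace
open Literature.MathematicalPhysics.KineticTheory

namespace Literature.Analysis.FluidPDE

/-! ### The Chu energy of a primitive fluctuation -/

section Generic

variable {F : Type*} [NormedAddCommGroup F]

/-- **Chu energy density** of a primitive fluctuation `(ρ′, u′, θ′)` (density, velocity,
temperature) about a background of density `ρ_b` and temperature `θ_b`, for a fluid with specific
heat at constant volume `c_v` (per unit mass) and isothermal pressure derivative
`a = (∂p/∂ρ)_θ` at the background: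
`e = (ρ_b ‖u′‖² + (a/ρ_b) ρ′² + (ρ_b c_v/θ_b) θ′²)/2`. Ideal gas (`a = Rθ_b`): Mack's energy norm
used by Hanifi–Schmid–Henningson 1996, §II; Dwivedi et al. 2020, eq. (5): "obtained by eliminating
conservative compression work transfer terms".
[cite: Chu1965, Part I (disturbance energy); HanifiSchmidHenningson1996 §II; DwivediEtAl2020 eq. (5) (arXiv:1901.09132, p. 4)] -/
def chuEnergyDensity (cv ρb θb a ρ' : ℝ) (u' : F) (θ' : ℝ) : ℝ :=
  (ρb * ‖u'‖ ^ 2 + a / ρb * ρ' ^ 2 + ρb * cv / θb * θ' ^ 2) / 2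

/-- Unfolding lemma for `chuEnergyDensity`. [folklore] -/
theorem chuEnergyDensity_def (cv ρb θb a ρ' : ℝ) (u' : F) (θ' : ℝ) :
    chuEnergyDensity cv ρb θb a ρ' u' θ' =
      (ρb * ‖u'‖ ^ 2 + a / ρb * ρ' ^ 2 + ρb * cv / θb * θ' ^ 2) / 2 := rfl

/-- The zero fluctuation has zero Chu energy density. [folklore] -/
@[simp] theorem chuEnergyDensity_zero (cv ρb θb a : ℝ) :
    chuEnergyDensity cv ρb θb a 0 (0 : F) 0 = 0 := by
  simp [chuEnergyDensity]

/-- The Chu energy density is a quadratic form: scaling the fluctuation by `c` scales it by `c²`.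
[folklore] -/
theorem chuEnergyDensity_smul [NormedSpace ℝ F] (cv ρb θb a ρ' : ℝ) (u' : F) (θ' c : ℝ) :
    chuEnergyDensity cv ρb θb a (c * ρ') (c • u') (c * θ') =
      c ^ 2 * chuEnergyDensity cv ρb θb a ρ' u' θ' := by
  simp only [chuEnergyDensity, norm_smul, Real.norm_eq_abs, mul_pow, sq_abs]
  ring

/-- The Chu energy density is non-negative for a thermodynamically stable background
(`ρ_b, θ_b > 0`, `(∂p/∂ρ)_θ ≥ 0`, `c_v ≥ 0`).
[cite: Chu1965, Part I (positive definiteness); HanifiSchmidHenningson1996 §II] -/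
theorem chuEnergyDensity_nonneg {cv ρb θb a : ℝ} (hcv : 0 ≤ cv) (hρ : 0 < ρb) (hθ : 0 < θb)
    (ha : 0 ≤ a) (ρ' : ℝ) (u' : F) (θ' : ℝ) : 0 ≤ chuEnergyDensity cv ρb θb a ρ' u' θ' := by
  unfold chuEnergyDensity
  positivity

/-- Positive definiteness: for `ρ_b, θ_b, (∂p/∂ρ)_θ, c_v > 0` the Chu energy density vanishes only
at the zero fluctuation. [cite: Chu1965, Part I (positive definiteness); HanifiSchmidHenningson1996 §II] -/
theorem chuEnergyDensity_eq_zero_iff {cv ρb θb a : ℝ} (hcv : 0 < cv) (hρ : 0 < ρb) (hθ : 0 < θb)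
    (ha : 0 < a) {ρ' : ℝ} {u' : F} {θ' : ℝ} :
    chuEnergyDensity cv ρb θb a ρ' u' θ' = 0 ↔ ρ' = 0 ∧ u' = 0 ∧ θ' = 0 := by
  constructor
  · intro h
    have h1 : 0 ≤ ρb * ‖u'‖ ^ 2 := by positivity
    have h2 : 0 ≤ a / ρb * ρ' ^ 2 := by positivity
    have h3 : 0 ≤ ρb * cv / θb * θ' ^ 2 := by positivity
    have hsum : ρb * ‖u'‖ ^ 2 + a / ρb * ρ' ^ 2 + ρb * cv / θb * θ' ^ 2 = 0 := by
      unfold chuEnergyDensity at h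
      linarith
    have e1 : ρb * ‖u'‖ ^ 2 = 0 := by linarith
    have e2 : a / ρb * ρ' ^ 2 = 0 := by linarith
    have e3 : ρb * cv / θb * θ' ^ 2 = 0 := by linarith
    refine ⟨?_, ?_, ?_⟩
    · simpa [(div_pos ha hρ).ne'] using e2
    · simpa [hρ.ne'] using e1
    · simpa [(div_pos (mul_pos hρ hcv) hθ).ne'] using e3
  · rintro ⟨rfl, rfl, rfl⟩
    exact chuEnergyDensity_zero cv ρb θb a

/-- **Conservation structure of the Chu weights** (the defining property of Chu's energy). Along
the inviscid equations linearised about the UNIFORM state `(ρ_b, 0, θ_b)` of a fluid with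
equation of state `p(ρ, θ)` (`a = ∂_ρ p`, `b = ∂_θ p` at the background) and constant `c_v` —
mass `ρ′_t = −ρ_b div u′`, momentum `ρ_b u′_t = −∇p′`, internal energy
`ρ_b c_v θ′_t = −θ_b b div u′` — evaluated at one point (`δ = div u′`, `g = ∇p′` there), the
Chu energy density satisfies `d/dt e = −(⟪u′, ∇p′⟫ + p′ div u′)` with `p′ = a ρ′ + b θ′`, i.e.
`−div(p′u′)`: the compression-work transfer terms are conservative and `∫ e` is constant on the
torus. [cite: Chu1965, Part I; HanifiSchmidHenningson1996 §II; DwivediEtAl2020 p. 4 (conservative compression-work transfer terms)] -/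
theorem chuEnergyDensity_hasDerivAt_of_linearizedEuler [InnerProductSpace ℝ F] {cv ρb θb a b : ℝ}
    (hρ : ρb ≠ 0) (hθ : θb ≠ 0) {ρ' θ' : ℝ → ℝ} {u' : ℝ → F} {dρ dθ δ : ℝ}
    {du g : F} {t : ℝ} (hρ' : HasDerivAt ρ' dρ t) (hu' : HasDerivAt u' du t)
    (hθ' : HasDerivAt θ' dθ t) (mass : dρ = -(ρb * δ)) (momentum : ρb • du = -g)
    (energy : ρb * cv * dθ = -(θb * b * δ)) :
    HasDerivAt (fun s => chuEnergyDensity cv ρb θb a (ρ' s) (u' s) (θ' s))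
      (-(⟪u' t, g⟫_ℝ + (a * ρ' t + b * θ' t) * δ)) t := by
  have hd : HasDerivAt (fun s => chuEnergyDensity cv ρb θb a (ρ' s) (u' s) (θ' s))
      ((ρb * (2 * ⟪u' t, du⟫_ℝ) + a / ρb * ((2 : ℕ) * ρ' t ^ (2 - 1) * dρ) +
        ρb * cv / θb * ((2 : ℕ) * θ' t ^ (2 - 1) * dθ)) / 2) t :=
    (((hu'.norm_sq.const_mul ρb).add ((hρ'.pow 2).const_mul (a / ρb))).add
      ((hθ'.pow 2).const_mul (ρb * cv / θb))).div_const 2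
  refine hd.congr_deriv ?_
  have hinner : ρb * ⟪u' t, du⟫_ℝ = -⟪u' t, g⟫_ℝ := by
    rw [← real_inner_smul_right, momentum, inner_neg_right]
  have hdρ : a / ρb * (ρ' t * dρ) = -(a * ρ' t * δ) := by
    rw [mass]
    field_simp
  have hdθ : ρb * cv / θb * (θ' t * dθ) = -(b * θ' t * δ) := by
    have h1 : ρb * cv / θb * (θ' t * dθ) = θ' t * (ρb * cv * dθ) / θb := by ring
    rw [h1, energy]
    field_simp
  simp only [Nat.cast_ofNat, Nat.reduceSub, pow_one]
  linear_combination hinner + hdρ + hdθ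

/-- **Chu energy** of a primitive fluctuation field `(ρ′, u′, θ′)` on a measure space `Ω` (the
flat torus `𝕋^d` in the applications) about a background `(ρ_b, θ_b)` that may vary in space, with
isothermal pressure derivative field `a = (∂p/∂ρ)_θ(ρ_b, θ_b)`:
`E = ∫ chuEnergyDensity c_v ρ_b θ_b a ρ′ u′ θ′` (Bochner integral; junk `0` if not integrable).
[cite: HanifiSchmidHenningson1996, §II (energy norm); Chu1965 Part I; DwivediEtAl2020 eq. (5)] -/
def chuEnergy {Ω : Type*} [MeasureSpace Ω] (cv : ℝ) (ρb θb a ρ' : Ω → ℝ) (u' : Ω → F)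
    (θ' : Ω → ℝ) : ℝ :=
  ∫ x, chuEnergyDensity cv (ρb x) (θb x) (a x) (ρ' x) (u' x) (θ' x)

/-- The Chu energy is non-negative for a thermodynamically stable background.
[cite: Chu1965, Part I (positive definiteness)] -/
theorem chuEnergy_nonneg {Ω : Type*} [MeasureSpace Ω] {cv : ℝ} {ρb θb a : Ω → ℝ} (hcv : 0 ≤ cv)
    (hρ : ∀ x, 0 < ρb x) (hθ : ∀ x, 0 < θb x) (ha : ∀ x, 0 ≤ a x) (ρ' : Ω → ℝ) (u' : Ω → F)
    (θ' : Ω → ℝ) : 0 ≤ chuEnergy cv ρb θb a ρ' u' θ' :=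
  integral_nonneg fun x => chuEnergyDensity_nonneg hcv (hρ x) (hθ x) (ha x) _ _ _

/-- The zero fluctuation field has zero Chu energy. [folklore] -/
@[simp] theorem chuEnergy_zero {Ω : Type*} [MeasureSpace Ω] (cv : ℝ) (ρb θb a : Ω → ℝ) :
    chuEnergy cv ρb θb a (fun _ => 0) (fun _ => (0 : F)) (fun _ => 0) = 0 := by
  simp [chuEnergy]

end Generic

/-! ### Hard spheres: primitive fluctuations of a conservative perturbation -/

section HardSphere

/-- The **isothermal pressure derivative** `(∂p/∂ρ)_θ` of the hard-sphere pressure law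
`p = hsPressure σ ρ θ = ρ θ Z(ρσ³)`: Mathlib's `deriv` in `ρ` (equal to `θ (ηZ)′(η)`, `η = ρσ³`,
where `Z` is differentiable — `hsPressureDrho_eq`; junk `0` elsewhere; `= θ` for the ideal gas
`σ = 0`). [folklore] -/
def hsPressureDrho (σ ρ θ : ℝ) : ℝ :=
  deriv (fun r => hsPressure σ r θ) ρ

/-- Ideal gas (`σ = 0`, `Z = 1`, `p = ρθ`): `(∂p/∂ρ)_θ = θ`. [folklore] -/
@[simp] theorem hsPressureDrho_zero_diam (ρ θ : ℝ) : hsPressureDrho 0 ρ θ = θ := by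
  have h : (fun r : ℝ => hsPressure 0 r θ) = fun r => r * θ := by
    funext r
    simp [hsPressure, hsCompressibility]
  rw [hsPressureDrho, h, (hasDerivAt_mul_const θ).deriv]

/-- Where the compressibility factor is differentiable, `(∂p/∂ρ)_θ = θ (Z(η) + η Z′(η))`
`= θ (ηZ)′(η)` with `η = ρσ³`. [folklore] -/
theorem hsPressureDrho_eq {σ ρ θ Z' : ℝ} (hZ : HasDerivAt hsCompressibility Z' (ρ * σ ^ 3)) :
    hsPressureDrho σ ρ θ = θ * (hsCompressibility (ρ * σ ^ 3) + ρ * σ ^ 3 * Z') := by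
  have h1 : HasDerivAt (fun r : ℝ => hsCompressibility (r * σ ^ 3)) (Z' * σ ^ 3) ρ :=
    (hZ.comp ρ (hasDerivAt_mul_const (σ ^ 3)) :)
  have h2 : HasDerivAt (fun r : ℝ => hsPressure σ r θ)
      (θ * hsCompressibility (ρ * σ ^ 3) + ρ * θ * (Z' * σ ^ 3)) ρ :=
    (hasDerivAt_mul_const θ).mul h1
  rw [hsPressureDrho, h2.deriv]
  ring

namespace HsState

/-- The **linearised velocity fluctuation** of a conservative perturbation `V = (δρ, δm, δE)` at a
background with density `ρ_b` and velocity `u_b`: `δu = (δm − δρ u_b)/ρ_b`, the derivative of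
`HsState.velocity = m/ρ` along `V` (junk at vacuum from `0⁻¹ = 0`). [folklore] -/
def linVelocity (ρb : ℝ) (ub : V3) (V : HsState) : V3 :=
  ρb⁻¹ • (V.momentum - V.density • ub)

/-- The **linearised temperature fluctuation** of a conservative perturbation `V = (δρ, δm, δE)` of
the hard-sphere gas (`E = ρ(|u|²/2 + 3θ/2)`) at the background `(ρ_b, u_b, θ_b)`:
`δθ = (2/(3ρ_b)) (δE − ⟪u_b, δm⟫ + (|u_b|²/2 − 3θ_b/2) δρ)`, the derivative of
`HsState.temperature` along `V`. [folklore] -/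
def linTemperature (ρb : ℝ) (ub : V3) (θb : ℝ) (V : HsState) : ℝ :=
  2 / (3 * ρb) * (V.energy - ⟪ub, V.momentum⟫_ℝ + (‖ub‖ ^ 2 / 2 - 3 / 2 * θb) * V.density)

/-- `linVelocity` is additive in the perturbation. [folklore] -/
theorem linVelocity_add (ρb : ℝ) (ub : V3) (V W : HsState) :
    linVelocity ρb ub (V + W) = linVelocity ρb ub V + linVelocity ρb ub W := by
  have hm : (V + W).momentum = V.momentum + W.momentum := map_add momentumL V W
  have hd : (V + W).density = V.density + W.density := map_add densityL V W
  rw [linVelocity, linVelocity, linVelocity, hm, hd, ← smul_add, add_smul]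
  congr 1
  abel

/-- `linTemperature` is additive in the perturbation. [folklore] -/
theorem linTemperature_add (ρb : ℝ) (ub : V3) (θb : ℝ) (V W : HsState) :
    linTemperature ρb ub θb (V + W) = linTemperature ρb ub θb V + linTemperature ρb ub θb W := by
  have hm : (V + W).momentum = V.momentum + W.momentum := map_add momentumL V W
  have hd : (V + W).density = V.density + W.density := map_add densityL V W
  have he : (V + W).energy = V.energy + W.energy := map_add energyL V W
  rw [linTemperature, linTemperature, linTemperature, hm, hd, he, inner_add_right]
  ring

end HsState

/-- The **linearised conservative state**: the derivative of
`(ρ, u, θ) ↦ consState ρ u θ = (ρ, ρu, ρ(|u|²/2 + 3θ/2))` at the background `(ρ_b, u_b, θ_b)` in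
the direction of the primitive fluctuation `(δρ, δu, δθ)`:
`(δρ, δρ u_b + ρ_b δu, δρ(|u_b|²/2 + 3θ_b/2) + ρ_b(⟪u_b, δu⟫ + (3/2)δθ))`
(`hasDerivAt_consState`). [folklore] -/
def linConsState (ρb : ℝ) (ub : V3) (θb δρ : ℝ) (δu : V3) (δθ : ℝ) : HsState :=
  HsState.mk δρ (δρ • ub + ρb • δu)
    (δρ * (‖ub‖ ^ 2 / 2 + 3 / 2 * θb) + ρb * (⟪ub, δu⟫_ℝ + 3 / 2 * δθ))

/-- `linConsState` is the derivative of `consState` along the affine path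
`κ ↦ (ρ_b + κ δρ, u_b + κ δu, θ_b + κ δθ)` at `κ = 0`: `(δρ, δu, δθ)` are the primitive
fluctuations of the conservative perturbation `linConsState ρ_b u_b θ_b δρ δu δθ`. [folklore] -/
theorem hasDerivAt_consState (ρb θb δρ δθ : ℝ) (ub δu : V3) :
    HasDerivAt (fun κ : ℝ => consState (ρb + κ * δρ) (ub + κ • δu) (θb + κ * δθ))
      (linConsState ρb ub θb δρ δu δθ) 0 := by
  have hρ : HasDerivAt (fun κ : ℝ => ρb + κ * δρ) δρ 0 := by
    simpa using (hasDerivAt_mul_const δρ).const_add ρb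
  have hu : HasDerivAt (fun κ : ℝ => ub + κ • δu) δu 0 := by
    simpa using ((hasDerivAt_id (0 : ℝ)).smul_const δu).const_add ub
  have hθ : HasDerivAt (fun κ : ℝ => θb + κ * δθ) δθ 0 := by
    simpa using (hasDerivAt_mul_const δθ).const_add θb
  have hm : HasDerivAt (fun κ : ℝ => (ρb + κ * δρ) • (ub + κ • δu))
      ((ρb + 0 * δρ) • δu + δρ • (ub + (0 : ℝ) • δu)) 0 :=
    hρ.smul hu
  have hE : HasDerivAt (fun κ : ℝ => totalEnergyDensity (ρb + κ * δρ) (ub + κ • δu) (θb + κ * δθ))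
      (δρ * (‖ub + (0 : ℝ) • δu‖ ^ 2 / 2 + 3 / 2 * (θb + 0 * δθ)) +
        (ρb + 0 * δρ) * (2 * ⟪ub + (0 : ℝ) • δu, δu⟫_ℝ / 2 + 3 / 2 * δθ)) 0 :=
    hρ.mul ((hu.norm_sq.div_const 2).add (hθ.const_mul (3 / 2)))
  have h : HasDerivAt (fun κ : ℝ => consState (ρb + κ * δρ) (ub + κ • δu) (θb + κ * δθ))
      (HsState.mkL (δρ, (ρb + 0 * δρ) • δu + δρ • (ub + (0 : ℝ) • δu),
        δρ * (‖ub + (0 : ℝ) • δu‖ ^ 2 / 2 + 3 / 2 * (θb + 0 * δθ)) +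
          (ρb + 0 * δρ) * (2 * ⟪ub + (0 : ℝ) • δu, δu⟫_ℝ / 2 + 3 / 2 * δθ))) 0 :=
    HsState.mkL.hasFDerivAt.comp_hasDerivAt (0 : ℝ) (hρ.prodMk (hm.prodMk hE))
  refine h.congr_deriv ?_
  rw [HsState.mkL_apply, linConsState, HsState.mk_eq_mk_iff]
  refine ⟨rfl, ?_, ?_⟩
  · simp only [zero_mul, add_zero, zero_smul]
    exact add_comm _ _
  · simp only [zero_mul, add_zero, zero_smul]
    ring

/-- The density component of `linConsState` is `δρ`. [folklore] -/
@[simp] theorem density_linConsState (ρb : ℝ) (ub : V3) (θb δρ : ℝ) (δu : V3) (δθ : ℝ) :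
    (linConsState ρb ub θb δρ δu δθ).density = δρ := rfl

/-- Away from vacuum, `linVelocity` recovers `δu` from `linConsState`. [folklore] -/
theorem linVelocity_linConsState {ρb : ℝ} (hρ : ρb ≠ 0) (ub : V3) (θb δρ : ℝ) (δu : V3)
    (δθ : ℝ) : (linConsState ρb ub θb δρ δu δθ).linVelocity ρb ub = δu := by
  simp [HsState.linVelocity, linConsState, smul_smul, inv_mul_cancel₀ hρ]

/-- Away from vacuum, `linTemperature` recovers `δθ` from `linConsState`. [folklore] -/
theorem linTemperature_linConsState {ρb : ℝ} (hρ : ρb ≠ 0) (ub : V3) (θb δρ : ℝ) (δu : V3)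
    (δθ : ℝ) : (linConsState ρb ub θb δρ δu δθ).linTemperature ρb ub θb = δθ := by
  simp only [HsState.linTemperature, linConsState, HsState.energy_mk, HsState.momentum_mk,
    HsState.density_mk, inner_add_right, inner_smul_right, real_inner_self_eq_norm_sq]
  field_simp
  ring

/-- Away from vacuum, every conservative perturbation is `linConsState` of its primitive
fluctuations `(δρ, δu, δθ) = (V.density, V.linVelocity, V.linTemperature)`. [folklore] -/
theorem linConsState_linVelocity_linTemperature {ρb : ℝ} (hρ : ρb ≠ 0) (ub : V3) (θb : ℝ)
    (V : HsState) :
    linConsState ρb ub θb V.density (V.linVelocity ρb ub) (V.linTemperature ρb ub θb) = V := by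
  have hu : V.density • ub + ρb • V.linVelocity ρb ub = V.momentum := by
    simp only [HsState.linVelocity, smul_smul, mul_inv_cancel₀ hρ, one_smul, add_sub_cancel]
  have hE : V.density * (‖ub‖ ^ 2 / 2 + 3 / 2 * θb) +
      ρb * (⟪ub, V.linVelocity ρb ub⟫_ℝ + 3 / 2 * V.linTemperature ρb ub θb) = V.energy := by
    simp only [HsState.linVelocity, HsState.linTemperature, inner_smul_right, inner_sub_right,
      real_inner_self_eq_norm_sq]
    field_simp
    ring
  rw [linConsState, hu, hE]
  exact (HsState.eq_mk V).symm

/-! ### Hard spheres: the Chu energy of a conservative perturbation -/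

/-- **Chu energy density of a conservative hard-sphere perturbation** `V ∈ ℝ⁵` at the background
`(ρ_b, u_b, θ_b)`: `chuEnergyDensity` with `c_v = 3/2`, `a = hsPressureDrho σ ρ_b θ_b`, evaluated on
the primitive fluctuations `(V.density, V.linVelocity, V.linTemperature)`.
[cite: HanifiSchmidHenningson1996, §II (energy norm); Chu1965 Part I] -/
def hsChuEnergyDensity (σ ρb : ℝ) (ub : V3) (θb : ℝ) (V : HsState) : ℝ :=
  chuEnergyDensity (3 / 2) ρb θb (hsPressureDrho σ ρb θb) V.density (V.linVelocity ρb ub)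
    (V.linTemperature ρb ub θb)

/-- In primitive fluctuations the hard-sphere Chu energy density is the displayed formula
`(ρ_b |δu|² + (θ_b (ηZ)′/ρ_b) δρ² + (3ρ_b/(2θ_b)) δθ²)/2`.
[cite: HanifiSchmidHenningson1996, §II (energy norm); Chu1965 Part I] -/
theorem hsChuEnergyDensity_linConsState (σ : ℝ) {ρb : ℝ} (hρ : ρb ≠ 0) (ub : V3) (θb δρ : ℝ)
    (δu : V3) (δθ : ℝ) :
    hsChuEnergyDensity σ ρb ub θb (linConsState ρb ub θb δρ δu δθ) =
      chuEnergyDensity (3 / 2) ρb θb (hsPressureDrho σ ρb θb) δρ δu δθ := by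
  rw [hsChuEnergyDensity, linVelocity_linConsState hρ, linTemperature_linConsState hρ,
    density_linConsState]

/-- Ideal gas (`σ = 0`): the weights are `ρ_b |δu|²`, `θ_b δρ²/ρ_b` and `3ρ_b δθ²/(2θ_b)` (Mack's
energy norm `diag(T̄/(γM²ρ̄), ρ̄, ρ̄, ρ̄, ρ̄/(γ(γ−1)T̄M²))` in units `R = 1`, `c_v = 3/2`).
[cite: HanifiSchmidHenningson1996, §II (energy norm)] -/
theorem hsChuEnergyDensity_zero_diam (ρb : ℝ) (ub : V3) (θb : ℝ) (V : HsState) :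
    hsChuEnergyDensity 0 ρb ub θb V =
      (ρb * ‖V.linVelocity ρb ub‖ ^ 2 + θb / ρb * V.density ^ 2 +
        3 * ρb / (2 * θb) * V.linTemperature ρb ub θb ^ 2) / 2 := by
  rw [hsChuEnergyDensity, hsPressureDrho_zero_diam, chuEnergyDensity]
  ring

/-- The hard-sphere Chu energy density is non-negative when `ρ_b, θ_b > 0` and
`(∂p/∂ρ)_θ ≥ 0` (mechanical stability of the background). [cite: Chu1965, Part I (positive definiteness)] -/
theorem hsChuEnergyDensity_nonneg {σ ρb θb : ℝ} (hρ : 0 < ρb) (hθ : 0 < θb)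
    (ha : 0 ≤ hsPressureDrho σ ρb θb) (ub : V3) (V : HsState) :
    0 ≤ hsChuEnergyDensity σ ρb ub θb V :=
  chuEnergyDensity_nonneg (by norm_num) hρ hθ ha _ _ _

/-- The zero perturbation has zero hard-sphere Chu energy density. [folklore] -/
@[simp] theorem hsChuEnergyDensity_zero (σ ρb : ℝ) (ub : V3) (θb : ℝ) :
    hsChuEnergyDensity σ ρb ub θb 0 = 0 := by
  have hm : (0 : HsState).momentum = 0 := map_zero HsState.momentumL
  have hd : (0 : HsState).density = 0 := map_zero HsState.densityL
  have he : (0 : HsState).energy = 0 := map_zero HsState.energyL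
  simp [hsChuEnergyDensity, HsState.linVelocity, HsState.linTemperature, hm, hd, he]

/-- **Chu energy of a conservative hard-sphere perturbation field** `V : 𝕋³ → ℝ⁵` about the
background fields `(ρ_b, u_b, θ_b)` (which may vary over the torus):
`E(V) = ∫_{𝕋³} hsChuEnergyDensity σ ρ_b u_b θ_b V = ½ ∫ [ρ_b|δu|² + ((∂p/∂ρ)_θ/ρ_b) δρ² +
(3ρ_b/(2θ_b)) δθ²]` — the requested `chuEnergy ρ_b θ_b V`.
[cite: HanifiSchmidHenningson1996, §II (energy norm); Chu1965 Part I] -/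
def hsChuEnergy (σ : ℝ) (ρb : T3 → ℝ) (ub : T3 → V3) (θb : T3 → ℝ) (V : T3 → HsState) : ℝ :=
  ∫ x, hsChuEnergyDensity σ (ρb x) (ub x) (θb x) (V x)

/-- `hsChuEnergy` is the generic `chuEnergy` (with `c_v = 3/2`, `a = hsPressureDrho`) of the
primitive fluctuations of `V`. [folklore] -/
theorem hsChuEnergy_eq_chuEnergy (σ : ℝ) (ρb : T3 → ℝ) (ub : T3 → V3) (θb : T3 → ℝ)
    (V : T3 → HsState) :
    hsChuEnergy σ ρb ub θb V =
      chuEnergy (3 / 2) ρb θb (fun x => hsPressureDrho σ (ρb x) (θb x)) (fun x => (V x).density)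
        (fun x => (V x).linVelocity (ρb x) (ub x)) (fun x => (V x).linTemperature (ρb x) (ub x) (θb x)) :=
  rfl

/-- The hard-sphere Chu energy is non-negative for a background with `ρ_b, θ_b > 0` and
`(∂p/∂ρ)_θ ≥ 0` everywhere. [cite: Chu1965, Part I (positive definiteness)] -/
theorem hsChuEnergy_nonneg {σ : ℝ} {ρb θb : T3 → ℝ} (hρ : ∀ x, 0 < ρb x) (hθ : ∀ x, 0 < θb x)
    (ha : ∀ x, 0 ≤ hsPressureDrho σ (ρb x) (θb x)) (ub : T3 → V3) (V : T3 → HsState) :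
    0 ≤ hsChuEnergy σ ρb ub θb V :=
  integral_nonneg fun x => hsChuEnergyDensity_nonneg (hρ x) (hθ x) (ha x) _ _

/-- The zero perturbation field has zero hard-sphere Chu energy. [folklore] -/
@[simp] theorem hsChuEnergy_zero (σ : ℝ) (ρb : T3 → ℝ) (ub : T3 → V3) (θb : T3 → ℝ) :
    hsChuEnergy σ ρb ub θb (fun _ => 0) = 0 := by
  simp [hsChuEnergy]

end HardSphere

end Literature.Analysis.FluidPDE

end
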